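import Summits.KontsevichZagierPeriods.Zeta5Search.Denom.TwoTaleD1Forms
import Summits.KontsevichZagierPeriods.Zeta5Search.TwoTaleP15LineBoundDecay
import Summits.KontsevichZagierPeriods.Zeta5Search.TwoTaleSecondTaleD1StripShift
import Summits.KontsevichZagierPeriods.Zeta5Search.TwoTaleSecondTaleD1LineRate
import Summits.KontsevichZagierPeriods.Zeta5Search.TwoTaleD1SecondLineCertificate
import Summits.KontsevichZagierPeriods.Zeta5Search.TwoTaleSecondTaleLineDecay
import Summits.KontsevichZagierPeriods.Zeta5Search.Denom.TwoTaleP15DecayHolds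

/-!
# Second tale at the D1 = L(1/3) partner: `DecayTD1 c` from the one-variable certificate — `DecayTD1 42.3343` PROVED

HONEST FRAMING: systematic search; no irrationality claim unless certified.  Cell pub-zeta5 (P1 g12 draft of files
M3/M4 of fam-denom's `families/denom/D1-DESIGN-NOTE.md`; design `families/measure/D1-DECAYT-DESIGN.md` (fam-measure g7);
the P15 files `TwoTaleSecondTaleLineDecay` + `TwoTaleSecondTaleDecayHolds` are followed line by line).  No measure or
irrationality claim is made here: `DecayTD1` is an INPUT of the W1 coincidence at D1 (floor `40.6`), itself part of a
design for an irrationality-MEASURE bound for the known-irrational `π²`.  With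
* `TwoTaleSecondTaleD1StripShift.abs_formT_le_of_lineD1` (PROVED): `|q̂ₙζ(2) − p̂ₙ| ≤ (4π)⁻¹ ∫ sech1(Y) ‖g(mₙ + ½ + iY)‖ dY`
  (`n ≥ 1`, `mₙ = 11n + ⌊16n/25⌋ ≤ 16n`), `g(u) = R̂ₙ((u − â₀*)/2)`, `sech1(Y) = π/cosh(πY) ≤ 2π e^{−π|Y|}`;
* `TwoTaleSecondTaleD1LineRate.log_norm_RCT_TD1_line_le` (PROVED): `g(mₙ + ½ + iY) = R̂ₙ(wₙ + i·Y/2)`,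
  `wₙ = −27n/2 − ¾ + ⌊16n/25⌋/2`, and with `η = Y/(2n)`: `log ‖R̂ₙ(wₙ + i nη)‖ ≤ n·rateTD1 η + 8 log(19² + (2η)²) + constLineTD1`;
the decay input follows from ONE explicit inequality for the elementary function `rateTD1`:
* `lineIntegrandTD1_le`, `integral_lineIntegrandTD1_le` (majorant `(484+Y²)⁹ e^{−(δ/2)|Y|}` of P1 g9);
* **`decayTD1_of_certificate`**: `0 < δ` → `(∀ η ≠ 0, rateTD1 η − (2π − δ)|η| ≤ M)` → `c < −M` → `DecayTD1 c`;
* `rateTD1_eq`: `rateTD1 η = profileTD10 (−1318/100) η` (`η ≠ 0`; `prim = gPrim`, `gPrim_scale` at `c = 2`, the doubled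
  block's `25 log 2`);
* `decayTD1_of_certTD1` (the shape of `TwoTaleD1SecondLineCertificate.certTD1_delta`, `δ = min 3 ((42.33437 − c)/22)`) and,
  with that kernel certificate: **`decayTD1_of_lt : c < 42.33437 → DecayTD1 c`**, `decayTD1_holds : DecayTD1 42.3343`,
  `decayTD1_holds_sharp : DecayTD1 42.33436`, `decayTD1_holds_floor : DecayTD1 40.6` (the W1 coincidence floor of D1).
Design: tale-2 saddle `ξ* = −13.17735`, `η* = 1.86926`, `C₀ᵀ = 42.33438300`; on the line `ξ₀ = −13.18`: `42.3343781`;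
certificate `42.33437`; this file `42.33436`/`42.3343` — far above the floor `40.6`.
References: W. Zudilin, arXiv:1310.1526 [Zudilin2014ZetaTwo] §6, Prop. 3, Remark 5.
-/

noncomputable section

open Real Complex MeasureTheory Filter
open Literature.NumberTheory.Irrationality.Zudilin2014
open Literature.NumberTheory.Transcendental (zetaValue)
open Summit.KontsevichZagierPeriods.Zeta5Search.Denom.TwoTaleD1Forms (aTD1 bTD1 DecayTD1)
open Summit.KontsevichZagierPeriods.Zeta5Search.TwoTaleLineBound
open Summit.KontsevichZagierPeriods.Zeta5Search.TwoTaleSechKernel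
open Summit.KontsevichZagierPeriods.Zeta5Search.TwoTaleSecondTaleD1StripShift (gTD abs_formT_le_of_lineD1)
open Summit.KontsevichZagierPeriods.Zeta5Search.TwoTaleSecondTaleD1LineRate
open Summit.KontsevichZagierPeriods.Zeta5Search.TwoTaleSecondTaleLineDecay (sech1_le_exp)
open Summit.KontsevichZagierPeriods.Zeta5Search.Denom.LineProfile (gPrim gPrim_scale)
open Summit.KontsevichZagierPeriods.Zeta5Search.Denom.TwoTaleP15DecayHolds (prim_eq_gPrim)
open Summit.KontsevichZagierPeriods.Zeta5Search.TwoTaleD1SecondLineProfileShape (profileTD10 profileTD1Const)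
open Summit.KontsevichZagierPeriods.Zeta5Search.TwoTaleD1SecondLineCertificate (certTD1_delta)

namespace Summit.KontsevichZagierPeriods.Zeta5Search.TwoTaleSecondTaleD1LineDecay

variable {M δ : ℝ}

/-- The `u`-line index `mₙ = 11n + ⌊16n/25⌋` (`Re u = mₙ + ½`, i.e. `Re t = wLineTD1 n`; `mₙ ≤ 16n`). -/
def mLineTD1 (n : ℕ) : ℕ := 11 * n + 16 * n / 25

/-- `mₙ ≤ 16n` (the strip-shift range). -/
theorem mLineTD1_le (n : ℕ) : mLineTD1 n ≤ 16 * n := by unfold mLineTD1; omega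

/-- **Pointwise bound on the line `Re u = mₙ + ½`** (`Y ≠ 0`, `n ≥ 1`), given the certificate with slope `2π − δ`. -/
theorem lineIntegrandTD1_le (hcert : ∀ η : ℝ, η ≠ 0 → rateTD1 η - (2 * π - δ) * |η| ≤ M) {n : ℕ} (hn : 1 ≤ n)
    {Y : ℝ} (hY : Y ≠ 0) :
    sech1 Y * ‖gTD n (((((mLineTD1 n : ℕ) : ℝ) + 1 / 2 : ℝ) : ℂ) + (Y : ℂ) * I)‖ ≤
      2 * π * Real.exp constLineTD1 * (484 + Y ^ 2) ^ 9 * Real.exp (n * M) * Real.exp (-(δ / 2 * |Y|)) := by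
  have hn0 : (0 : ℝ) < n := by exact_mod_cast (show 0 < n by omega)
  have hn1 : (1 : ℝ) ≤ n := by exact_mod_cast hn
  obtain ⟨η, hη⟩ : ∃ η : ℝ, η = Y / (2 * n) := ⟨_, rfl⟩
  have hη0 : η ≠ 0 := by rw [hη]; exact div_ne_zero hY (by positivity)
  have hyη : 2 * ((n : ℝ) * η) = Y := by rw [hη]; field_simp
  -- the line point: `g(mₙ + ½ + iY) = R̂(wₙ + i·nη)`
  have hpt : gTD n (((((mLineTD1 n : ℕ) : ℝ) + 1 / 2 : ℝ) : ℂ) + (Y : ℂ) * I) =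
      RCT (aTD1 n) (bTD1 n) ((wLineTD1 n : ℂ) + (((n : ℝ) * η : ℝ) : ℂ) * I) := by
    rw [← hyη]; unfold gTD wLineTD1 mLineTD1; congr 1; push_cast; ring
  rw [hpt]
  have hL := log_norm_RCT_TD1_line_le hη0 hn
  have hc := hcert η hη0
  -- scale the certificate: n·rateTD1 η ≤ n M + (2π − δ)·|Y|/2
  have habs : (n : ℝ) * |η| = |Y| / 2 := by
    rw [← hyη, abs_mul, abs_mul, abs_of_pos hn0, abs_two]; ring
  have hc' : (n : ℝ) * rateTD1 η ≤ n * M + (2 * π - δ) * (|Y| / 2) :=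
    calc (n : ℝ) * rateTD1 η = n * (rateTD1 η - (2 * π - δ) * |η|) + (2 * π - δ) * (n * |η|) := by ring
      _ ≤ n * M + (2 * π - δ) * (n * |η|) := by gcongr
      _ = n * M + (2 * π - δ) * (|Y| / 2) := by rw [habs]
  -- (2η)² = (Y/n)² ≤ Y² and 19² ≤ 484
  have hlog : Real.log (19 ^ 2 + (2 * η) ^ 2) ≤ Real.log (484 + Y ^ 2) := by
    apply Real.log_le_log (by positivity)
    have h2 : 2 * η = Y / n := by rw [hη]; field_simp
    have : (2 * η) ^ 2 ≤ Y ^ 2 := by rw [h2, div_pow]; exact div_le_self (sq_nonneg Y) (by nlinarith [hn1])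
    nlinarith
  have hlog0 : 0 ≤ Real.log (484 + Y ^ 2) := Real.log_nonneg (by nlinarith [sq_nonneg Y])
  have h89 : 8 * Real.log (19 ^ 2 + (2 * η) ^ 2) ≤ 9 * Real.log (484 + Y ^ 2) := by nlinarith [hlog, hlog0]
  -- log of the numerator
  have hlogR : Real.log ‖RCT (aTD1 n) (bTD1 n) ((wLineTD1 n : ℂ) + (((n : ℝ) * η : ℝ) : ℂ) * I)‖ ≤
      n * M + (2 * π - δ) * (|Y| / 2) + 9 * Real.log (484 + Y ^ 2) + constLineTD1 :=
    hL.trans (add_le_add (add_le_add hc' h89) le_rfl)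
  have hR : ‖RCT (aTD1 n) (bTD1 n) ((wLineTD1 n : ℂ) + (((n : ℝ) * η : ℝ) : ℂ) * I)‖ ≤
      Real.exp (n * M + (2 * π - δ) * (|Y| / 2) + 9 * Real.log (484 + Y ^ 2) + constLineTD1) := by
    rcases eq_or_lt_of_le (norm_nonneg (RCT (aTD1 n) (bTD1 n) ((wLineTD1 n : ℂ) + (((n : ℝ) * η : ℝ) : ℂ) * I)))
      with h0 | hpos
    · rw [← h0]; exact (Real.exp_pos _).le
    · exact (Real.log_le_iff_le_exp hpos).1 hlogR
  -- the exponentials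
  have hexp : Real.exp (n * M + (2 * π - δ) * (|Y| / 2) + 9 * Real.log (484 + Y ^ 2) + constLineTD1) =
      Real.exp constLineTD1 * (484 + Y ^ 2) ^ 9 * Real.exp (n * M) * Real.exp (-(δ / 2 * |Y|)) * Real.exp (π * |Y|) := by
    rw [show n * M + (2 * π - δ) * (|Y| / 2) + 9 * Real.log (484 + Y ^ 2) + constLineTD1 =
      constLineTD1 + 9 * Real.log (484 + Y ^ 2) + n * M + (-(δ / 2 * |Y|)) + π * |Y| by ring]
    rw [Real.exp_add, Real.exp_add, Real.exp_add, Real.exp_add,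
      show (9 : ℝ) * Real.log (484 + Y ^ 2) = Real.log ((484 + Y ^ 2) ^ 9) by rw [Real.log_pow]; push_cast; ring,
      Real.exp_log (by positivity)]
  have e : Real.exp (-(π * |Y|)) * Real.exp (π * |Y|) = 1 := by rw [← Real.exp_add, neg_add_cancel, Real.exp_zero]
  calc sech1 Y * ‖RCT (aTD1 n) (bTD1 n) ((wLineTD1 n : ℂ) + (((n : ℝ) * η : ℝ) : ℂ) * I)‖
      ≤ (2 * π * Real.exp (-(π * |Y|))) *
          Real.exp (n * M + (2 * π - δ) * (|Y| / 2) + 9 * Real.log (484 + Y ^ 2) + constLineTD1) :=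
        mul_le_mul (sech1_le_exp Y) hR (norm_nonneg _) (by positivity)
    _ = 2 * π * Real.exp constLineTD1 * (484 + Y ^ 2) ^ 9 * Real.exp (n * M) * Real.exp (-(δ / 2 * |Y|)) *
          (Real.exp (-(π * |Y|)) * Real.exp (π * |Y|)) := by rw [hexp]; ring
    _ = 2 * π * Real.exp constLineTD1 * (484 + Y ^ 2) ^ 9 * Real.exp (n * M) * Real.exp (-(δ / 2 * |Y|)) := by
        rw [e, mul_one]

/-- The integral of the majorant: `∫ sech1·‖g‖ ≤ 2π e^{constLineTD1} e^{nM} · ∫ (484+Y²)⁹ e^{−(δ/2)|Y|}` (`n ≥ 1`). -/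
theorem integral_lineIntegrandTD1_le (hδ : 0 < δ) (hcert : ∀ η : ℝ, η ≠ 0 → rateTD1 η - (2 * π - δ) * |η| ≤ M)
    {n : ℕ} (hn : 1 ≤ n) :
    ∫ Y : ℝ, sech1 Y * ‖gTD n (((((mLineTD1 n : ℕ) : ℝ) + 1 / 2 : ℝ) : ℂ) + (Y : ℂ) * I)‖ ≤
      2 * π * Real.exp constLineTD1 * Real.exp (n * M) * ∫ Y : ℝ, (484 + Y ^ 2) ^ 9 * Real.exp (-(δ / 2 * |Y|)) := by
  rw [← integral_const_mul]
  refine integral_mono_of_nonneg (Filter.Eventually.of_forall fun Y => mul_nonneg (sech1_nonneg Y) (norm_nonneg _))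
    ((integrable_poly_exp (δ := δ / 2) (by positivity)).const_mul _) ?_
  have h0 : ∀ᵐ Y : ℝ ∂volume, Y ≠ 0 := by
    have : (volume : Measure ℝ) {0} = 0 := measure_singleton 0
    filter_upwards [measure_eq_zero_iff_ae_notMem.1 this] with Y hY
    simpa using hY
  filter_upwards [h0] with Y hY
  have := lineIntegrandTD1_le hcert hn hY
  calc sech1 Y * ‖gTD n (((((mLineTD1 n : ℕ) : ℝ) + 1 / 2 : ℝ) : ℂ) + (Y : ℂ) * I)‖
      ≤ 2 * π * Real.exp constLineTD1 * (484 + Y ^ 2) ^ 9 * Real.exp (n * M) * Real.exp (-(δ / 2 * |Y|)) := this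
    _ = 2 * π * Real.exp constLineTD1 * Real.exp (n * M) * ((484 + Y ^ 2) ^ 9 * Real.exp (-(δ / 2 * |Y|))) := by ring

/-- **`DecayTD1 c` from the certificate**: if for some `δ > 0` and `M` the explicit rate function satisfies
`rateTD1 η − (2π − δ)|η| ≤ M` for all `η ≠ 0`, then `DecayTD1 c` holds for every `c < −M`
(line representation, strip shift, line bound and `dy`-assembly all PROVED in U2-1 … U2-6; only the one-variable
inequality is an input — the kernel certificate gives `M = −42.33437 + 11δ`, `0 ≤ δ ≤ 3`). -/
theorem decayTD1_of_certificate (hδ : 0 < δ) (hcert : ∀ η : ℝ, η ≠ 0 → rateTD1 η - (2 * π - δ) * |η| ≤ M) {c : ℝ}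
    (hc : c < -M) : DecayTD1 c := by
  unfold DecayTD1
  set ε : ℝ := -M - c with hεdef
  have hε : 0 < ε := by rw [hεdef]; linarith
  set A : ℝ := 1 / (4 * Real.pi) *
    (2 * π * Real.exp constLineTD1 * ∫ Y : ℝ, (484 + Y ^ 2) ^ 9 * Real.exp (-(δ / 2 * |Y|))) with hA
  -- eventually: A ≤ e^{εn}
  have hev : ∀ᶠ n : ℕ in atTop, A ≤ Real.exp (ε * n) := by
    have ht : Tendsto (fun n : ℕ => Real.exp (ε * n)) atTop atTop :=
      Real.tendsto_exp_atTop.comp (tendsto_natCast_atTop_atTop.const_mul_atTop hε)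
    exact ht.eventually_ge_atTop _
  filter_upwards [hev, Filter.eventually_ge_atTop 1] with n hK hn1
  have hI := integral_lineIntegrandTD1_le hδ hcert hn1
  calc |(formQT (aTD1 n) (bTD1 n) : ℝ) * zetaValue 2 - (formPT (aTD1 n) (bTD1 n) : ℝ)|
      ≤ 1 / (4 * Real.pi) * ∫ Y : ℝ, sech1 Y * ‖gTD n (((((mLineTD1 n : ℕ) : ℝ) + 1 / 2 : ℝ) : ℂ) + (Y : ℂ) * I)‖ :=
        abs_formT_le_of_lineD1 hn1 (mLineTD1_le n)
    _ ≤ 1 / (4 * Real.pi) * (2 * π * Real.exp constLineTD1 * Real.exp (n * M) *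
          ∫ Y : ℝ, (484 + Y ^ 2) ^ 9 * Real.exp (-(δ / 2 * |Y|))) := mul_le_mul_of_nonneg_left hI (by positivity)
    _ = A * Real.exp (n * M) := by rw [hA]; ring
    _ ≤ Real.exp (ε * n) * Real.exp (n * M) := by gcongr
    _ = Real.exp (-(c * n)) := by rw [← Real.exp_add]; congr 1; rw [hεdef]; ring

/-- **The two normal forms agree** (`η ≠ 0`): `rateTD1` (P1's `prim`, doubled block at height `2η`) is
`profileTD10 (−1318/100)` (`gPrim` form): `prim = gPrim`, `gPrim (2η) (2V) = 2(gPrim η V + V log 2)`, and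
`2·(258/25)·log 2 + 2·(109/50)·log 2 = 25 log 2`. -/
theorem rateTD1_eq {η : ℝ} (hη : η ≠ 0) : rateTD1 η = profileTD10 (-1318 / 100) η := by
  have h1 : prim (2 * η) (516 / 25) = 2 * (gPrim η (258 / 25) + 258 / 25 * Real.log 2) := by
    rw [prim_eq_gPrim, show (516 / 25 : ℝ) = 2 * (258 / 25) by norm_num]; exact gPrim_scale hη two_pos _
  have h2 : prim (2 * η) (-109 / 25) = 2 * (gPrim η (-109 / 50) + -109 / 50 * Real.log 2) := by
    rw [prim_eq_gPrim, show (-109 / 25 : ℝ) = 2 * (-109 / 50) by norm_num]; exact gPrim_scale hη two_pos _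
  simp only [rateTD1, kappaTD1, profileTD10, profileTD1Const, prim_eq_gPrim] at h1 h2 ⊢
  rw [h1, h2, show (-1318 / 100 : ℝ) + 47 / 2 = 258 / 25 by norm_num,
    show (-1318 / 100 : ℝ) + 11 = -109 / 50 by norm_num,
    show (-1318 / 100 : ℝ) + 16 = 141 / 50 by norm_num, show (-1318 / 100 : ℝ) + 9 = -209 / 50 by norm_num,
    show (-1318 / 100 : ℝ) + 35 = 1091 / 50 by norm_num, show (-1318 / 100 : ℝ) + 19 = 291 / 50 by norm_num,
    show (-1318 / 100 : ℝ) + 38 = 1241 / 50 by norm_num, show (-1318 / 100 : ℝ) + 22 = 441 / 50 by norm_num]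
  ring

/-- **`DecayTD1 c` for every `c < 42.33437` from a certificate of the shape of
`TwoTaleD1SecondLineCertificate.certTD1_delta`** (`0 ≤ δ ≤ 3`, slack `11δ`, abscissa `−1318/100`); take
`δ = min 3 ((42.33437 − c)/22)` in `decayTD1_of_certificate` and rewrite with `rateTD1_eq`. -/
theorem decayTD1_of_certTD1
    (hcert : ∀ δ : ℝ, 0 ≤ δ → δ ≤ 3 → ∀ η : ℝ, η ≠ 0 →
      profileTD10 (-1318 / 100) η - (2 * π - δ) * |η| ≤ -42.33437 + 11 * δ)
    {c : ℝ} (hc : c < 42.33437) : DecayTD1 c := by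
  have hδ0 : 0 < min 3 ((42.33437 - c) / 22) := lt_min (by norm_num) (by linarith)
  have hδc : min 3 ((42.33437 - c) / 22) ≤ (42.33437 - c) / 22 := min_le_right _ _
  refine decayTD1_of_certificate hδ0 (M := -42.33437 + 11 * min 3 ((42.33437 - c) / 22)) (fun η hη => ?_) (by linarith)
  rw [rateTD1_eq hη]
  exact hcert _ hδ0.le (min_le_left _ _) η hη

/-! ### `DecayTD1` holds -/

/-- **`DecayTD1 c` for every `c < 42.33437`**: the kernel interval certificate `certTD1_delta` fed into the
`dy`-assembly `decayTD1_of_certTD1`. -/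
theorem decayTD1_of_lt {c : ℝ} (hc : c < 42.33437) : DecayTD1 c :=
  decayTD1_of_certTD1 (fun _ h0 h3 η hη => certTD1_delta h0 h3 η hη) hc

/-- **`DecayTD1 42.3343` PROVED** (fam-measure's design proposal `DecayT_D1 42.33`). -/
theorem decayTD1_holds : DecayTD1 42.3343 := decayTD1_of_lt (by norm_num)

/-- `DecayTD1 42.33436` (sharp form on the line `ξ₀ = −1318/100`; design `42.3343781`). -/
theorem decayTD1_holds_sharp : DecayTD1 42.33436 := decayTD1_of_lt (by norm_num)

/-- `DecayTD1 40.6` — the W1 coincidence floor of D1 (`min(C₀, c′) > 50 − R = 40.539`). -/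
theorem decayTD1_holds_floor : DecayTD1 40.6 := decayTD1_of_lt (by norm_num)

end Summit.KontsevichZagierPeriods.Zeta5Search.TwoTaleSecondTaleD1LineDecay

end
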